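import Summits.BirchSwinnertonDyer.BirchSwinnertonDyer.Theorems.AlignedTransportAtTwoMainConjectureOfRankZeroBSDAtTwoCubicOffStratumFukudaIndexDoors
import Literature.NumberTheory.IwasawaTheory.ClassicalMuVanishesLayerTwoUnitCertificateTwo
import HarnessLib

/-!
# Route `AlignedTransportAtTwo`, crux C2 `MainConjectureOfRankZeroBSDAtTwo` (stmt-BirchSwinnertonDyer-22298):
# THE LAYER-TWO UNIT DOOR INTO `MC₂(W)` — off the stratum, when Chevalley's door at `ℚ(β) → ℚ(β,√2)` AND the layer-one unit door at
# `ℚ(β,√2) → ℚ(β,θ)` are void (the fundamental unit is a local norm from the second layer, `σ₁(ε) ≡ ±1 (mod 16)`), ONE unit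
# `A + Bθ + Cθ² + Dθ³` of `ℚ(β,θ)`, `θ⁴ − 4θ² + 2 = 0`, certified in `𝓞_{ℚ(β)}` gives `μ₂ = λ₂ = 0` for the cubic field and `MC₂(W)`

HONEST FRAMING (cell `bsd-f1-sign2`, WIDTH-5 attached prover seat `bsd-line-att-p3` gen 44 on line `birth` of the lead `bsd-line-att-p2`;
`--supports` stmt-BirchSwinnertonDyer-22298, closes nothing; BSD is NOT proved by any of this; the crux C2, its verdict «blocked-on
`Rank1Residual.GreenbergMuConjectureIrreducible`» and every registered stub are untouched).  THEOREMS ONLY — no definition, no named fact, no `sorry`.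
The rung-`2` twin of `…CubicLayerOneUnitDoor.lean` (this lineage, gen 41).

WHY.  On the off-stratum sub-cell `Δ_min ≡ 5 (mod 8)` of the seed cell the cubic `2`-torsion field `K = ℚ(β)` has `2 = 𝔭₁𝔭₂` (`f = 1, 2`); with
`h(K)` odd, Chevalley's door at `K → K₁ = K(√2)` fires iff `σ₁(ε) ≡ ±3 (mod 8)`, the layer-one unit door (gen 41) can fire only when
`σ₁(ε) ≡ ±7 (mod 16)`, and on the class `σ₁(ε) ≡ ±1 (mod 16)` (census: the rank-`0` seeds `N = 1187, 4307`, where moreover `e₁ ≥ 2` kills the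
depth door of gen 42/43) the first door that can fire is the unit door at the SECOND layer `K₂ = K(θ) → K₃ = K₂(√(2+θ))`, `θ⁴ − 4θ² + 2 = 0`
(it fires iff `e₃ = e₂`, iff the prime of `K₁` above `𝔭₂` does not capitulate in `K₂`; memo `LAYER-TWO-UNIT-DOOR-att-p3-g44.md`).  The Literature
file `IwasawaTheory/ClassicalMuVanishesLayerTwoUnitCertificateTwo.lean` (this seat) makes that a computation in `𝓞_K` ALONE: a prime `𝔭₁` of norm `2`
with `2 ∉ 𝔭₁²`, and `A, B, C, D, A', B', C', D', π₁, d, γ₀, γ₁, γ₂, γ₃ ∈ 𝓞_K` with the four coefficient identities of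
`(A + Bθ + Cθ² + Dθ³)(A' + B'θ + C'θ² + D'θ³) = 1` modulo `θ⁴ = 4θ² − 2`, `π₁ ∈ 𝔭₁ ∖ 𝔭₁²`, `d, γ₀ ∉ 𝔭₁`, `d(A − 1) = π₁²γ₀`, `dB = π₁²γ₁`,
`dC = π₁²γ₂`, `dD = π₁²γ₃`.

WHAT.
* **`classicalMuVanishes_adjoin_of_layerTwoUnitCert`** — `W` globally minimal, good ordinary at `2`, no rational `2`-torsion abscissa, OFF the Kilford
  stratum, `β` a root of the `2`-division cubic; displayed: `h(ℚ(β))` odd, the prime `𝔭₁` and the fourteen elements of `𝓞 ℚ(β)` above ⟹ every cyclotomic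
  `ℤ₂`-extension of `ℚ(β)` has `μ₂ = 0` AND `λ₂ = 0` (`e_m = e_2` for `m ≥ 2`).  Fukuda's index `0` is att-p5 g28's
  `totallyRamifiedFrom_zero_adjoin_of_isOrdinaryAt_two`, «at most two primes above `2`» is `ncard_adjoin_le_two_of_not_onKilfordStratumAtTwo`.
* **`mazurMainConjecture_two_of_muIneqRel_of_layerTwoUnitCert`** — PRINT⁵ {Kato 17.4 (1)(2) at `2`, Greenberg 4.1, period unit, modularity, GZK} +
  MuIneqʳ (registered stub verbatim) + the cell hypotheses (`Δ_W < 0`, `r_an = 0`, analytic `μ₂ = 0`, `BSD₂(W)`) + the same displayed data ⟹ `MC₂(W)`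
  (att-p5 g24's cubic carrier road `mazurMainConjecture_two_of_muIneqRel_of_classicalMu_cubicField_of_Δ_neg`).
* **`mazurMainConjecture_two_of_muIneqRel_of_layerTwoUnitCert_principal`** — the `h(ℚ(β)) = 1` form `𝔭₁ = (π₁)` with every side condition an identity.

CONDITIONAL theorems (PRINT⁵, MuIneqʳ displayed); nothing is asserted about any curve's class number or units (each certificate is a finite search in
`ℤ[θ]⁴` over the degree-`12` field `ℚ(β, θ)` per seed — CENSUS ASK in the crux memo `LAYER-TWO-UNIT-DOOR-att-p3-g44.md`); nothing is closed; BSD is not proved.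

References: [Fukuda1994] Thm. 1 (1), p. 264; [Lang1990] Ch. 13 §4, Lemma 4.1–4.2; [Omeara1963] §63B (63:10); [Washington1997] §13.1, §13.3 Prop. 13.22;
[Kato2004Asterisque] Thm. 17.4 (1)(2) (p. 273); [GreenbergLNM1716] Thm. 4.1 (p. 102), Conj. 1.11 (p. 58); [Iwasawa1973MuInvariants] Thm. 2/3; tree:
att-p5 g24 `…CubicCarrierRoad`, g28 `…CubicOffStratumFukudaIndex{,Doors}`, `…CubicOffStratumPrimes`; this seat's Literature files
`NumberFields/DyadicUnitSquaresRamifiedPrimeFour`, `IwasawaTheory/CyclotomicTwoLayerTwoDyadicPrimeCertificate`, `IwasawaTheory/ClassicalMuVanishesLayerTwoUnitCertificateTwo`.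
-/

set_option linter.dupNamespace false
set_option autoImplicit false

noncomputable section

open scoped Classical NumberField nonZeroDivisors

namespace Summit.BirchSwinnertonDyer.BirchSwinnertonDyer.Theorems.AlignedTransportAtTwoCubicLayerTwoUnitDoor

open NumberField IsDedekindDomain Polynomial WeierstrassCurve IntermediateField CongruenceSubgroup
  Literature.NumberTheory.IwasawaTheory Literature.NumberTheory.GaloisRepresentations
  Literature.NumberTheory.EllipticCurves Literature.NumberTheory.EllipticCurves.Greenberg1999
  Literature.NumberTheory.EllipticCurves.ModularForms
  Literature.NumberTheory.EllipticCurves.Rank1Residual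
  Literature.NumberTheory.EllipticCurves.Module
  Summit.BirchSwinnertonDyer.Rank1Residual
  Summit.BirchSwinnertonDyer.Rank1Residual.X1.MuLambda
  Summit.BirchSwinnertonDyer.Rank1Residual.X5
  Summit.BirchSwinnertonDyer.Rank1Residual.F1Sign2
  Summit.BirchSwinnertonDyer.BirchSwinnertonDyer.Theorems.Rank1ResidualX1Defs
  Summit.BirchSwinnertonDyer.BirchSwinnertonDyer.Theses.AlignedTransportAtTwo
  Summit.BirchSwinnertonDyer.BirchSwinnertonDyer.Theorems.AlignedTransportAtTwoKilfordStratumShared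
  Summit.BirchSwinnertonDyer.BirchSwinnertonDyer.Theorems.AlignedTransportAtTwoCubicCarrierRoad
  Summit.BirchSwinnertonDyer.BirchSwinnertonDyer.Theorems.AlignedTransportAtTwoCubicOffStratumPrimes
  Summit.BirchSwinnertonDyer.BirchSwinnertonDyer.Theorems.AlignedTransportAtTwoCubicOffStratumFukudaIndex

variable (W : WeierstrassCurve ℚ) [W.IsElliptic]

/-! ## §1 `μ₂ = 0`, `λ₂ = 0` for the cubic `2`-torsion field from the layer-two unit certificate -/

/-- **`μ₂(ℚ(β)^{cyc}) = 0` AND `λ₂ = 0` OFF THE STRATUM FROM THE LAYER-TWO UNIT CERTIFICATE.**  `W/ℚ` globally minimal, good ordinary at `2`, no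
rational `2`-torsion abscissa, OFF the Kilford stratum (at most two primes of `ℚ(β)` above `2`), `β ∈ ℚ̄` a root of the `2`-division cubic; displayed:
`h(ℚ(β))` odd, a prime `𝔭₁` of `𝓞 ℚ(β)` of norm `2` with `2 ∉ 𝔭₁²`, and `A, B, C, D, A', B', C', D', π₁, d, γ₀, γ₁, γ₂, γ₃ ∈ 𝓞 ℚ(β)` with the four
coefficient identities of `(A + Bθ + Cθ² + Dθ³)(A' + B'θ + C'θ² + D'θ³) = 1` modulo `θ⁴ = 4θ² − 2`, `π₁ ∈ 𝔭₁ ∖ 𝔭₁²`, `d, γ₀ ∉ 𝔭₁`,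
`d(A − 1) = π₁²γ₀`, `dB = π₁²γ₁`, `dC = π₁²γ₂`, `dD = π₁²γ₃` (so that `A + Bθ + Cθ² + Dθ³` is a unit of `ℚ(β, θ)`, `θ⁴ − 4θ² + 2 = 0`, that is not a
norm from `ℚ(β, θ, √(2+θ))`).  THEN every cyclotomic `ℤ₂`-extension of `ℚ(β)` has `e_m = e_2` for all `m ≥ 2`, `μ₂ = 0`, `λ₂ = 0` (Literature
`classicalMuVanishes_two_of_layerTwo_unitCert` with Fukuda's index `0` from att-p5 g28 `totallyRamifiedFrom_zero_adjoin_of_isOrdinaryAt_two`).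
[cite: Fukuda1994, Thm. 1 (1), p. 264] [cite: Lang1990, Ch. 13 §4, Lemma 4.1–4.2 (PDF pp. 203–204)] [cite: Omeara1963, §63B (63:10)] -/
theorem classicalMuVanishes_adjoin_of_layerTwoUnitCert [W.IsGloballyMinimal] (hord : IsOrdinaryAt W 2)
    (ht : ∀ x : ℚ, ¬ HasRationalTwoTorsionX W x) (hs : ¬ OnKilfordStratumAtTwo W)
    {β : AlgebraicClosure ℚ} (hβ : aeval β W.twoTorsionPolynomial.toPoly = 0)
    (hh : haveI : FiniteDimensional ℚ ↥(IntermediateField.adjoin ℚ ({β} : Set (AlgebraicClosure ℚ))) :=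
        IntermediateField.adjoin.finiteDimensional ((AlgebraicClosure.isAlgebraic ℚ).isAlgebraic β).isIntegral
      haveI : NumberField ↥(IntermediateField.adjoin ℚ ({β} : Set (AlgebraicClosure ℚ))) := NumberField.mk
      ¬ 2 ∣ classNumber ↥(IntermediateField.adjoin ℚ ({β} : Set (AlgebraicClosure ℚ))))
    (𝔭₁ : Ideal (𝓞 ↥(IntermediateField.adjoin ℚ ({β} : Set (AlgebraicClosure ℚ)))))
    (hN : haveI : FiniteDimensional ℚ ↥(IntermediateField.adjoin ℚ ({β} : Set (AlgebraicClosure ℚ))) :=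
        IntermediateField.adjoin.finiteDimensional ((AlgebraicClosure.isAlgebraic ℚ).isAlgebraic β).isIntegral
      haveI : NumberField ↥(IntermediateField.adjoin ℚ ({β} : Set (AlgebraicClosure ℚ))) := NumberField.mk
      Ideal.absNorm 𝔭₁ = 2)
    (hunr : (2 : 𝓞 ↥(IntermediateField.adjoin ℚ ({β} : Set (AlgebraicClosure ℚ)))) ∉ 𝔭₁ ^ 2)
    {A B C D A' B' C' D' π₁ d γ₀ γ₁ γ₂ γ₃ : 𝓞 ↥(IntermediateField.adjoin ℚ ({β} : Set (AlgebraicClosure ℚ)))}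
    (h0 : A * A' - 2 * (B * D' + C * C' + D * B') - 8 * (D * D') = 1)
    (h1 : A * B' + B * A' - 2 * (C * D' + D * C') = 0)
    (h2c : A * C' + B * B' + C * A' + 4 * (B * D' + C * C' + D * B') + 14 * (D * D') = 0)
    (h3 : A * D' + B * C' + C * B' + D * A' + 4 * (C * D' + D * C') = 0)
    (hπ₁ : π₁ ∈ 𝔭₁) (hπ₁' : π₁ ∉ 𝔭₁ ^ 2) (hd : d ∉ 𝔭₁) (hγ₀ : γ₀ ∉ 𝔭₁)
    (hA : d * (A - 1) = π₁ ^ 2 * γ₀) (hB : d * B = π₁ ^ 2 * γ₁) (hC : d * C = π₁ ^ 2 * γ₂) (hD : d * D = π₁ ^ 2 * γ₃)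
    (κP : ZpExtension ↥(IntermediateField.adjoin ℚ ({β} : Set (AlgebraicClosure ℚ))) 2) (hκP : κP.IsCyclotomic) :
    (∀ m : ℕ, 2 ≤ m → classNumberPExp κP m = classNumberPExp κP 2) ∧ ClassicalMuVanishes κP ∧ classicalLambda κP = 0 := by
  have hirr := AlignedTransportAtTwoSeed.irr_two_of_forall_not_hasRationalTwoTorsionX W ht
  have hβint : IsIntegral ℚ β := ((AlgebraicClosure.isAlgebraic ℚ).isAlgebraic β).isIntegral
  haveI : FiniteDimensional ℚ ↥(IntermediateField.adjoin ℚ ({β} : Set (AlgebraicClosure ℚ))) :=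
    IntermediateField.adjoin.finiteDimensional hβint
  haveI : NumberField ↥(IntermediateField.adjoin ℚ ({β} : Set (AlgebraicClosure ℚ))) := NumberField.mk
  have hfin3 : Module.finrank ℚ ↥(IntermediateField.adjoin ℚ ({β} : Set (AlgebraicClosure ℚ))) = 3 :=
    AddKatoTwo.finrank_adjoin_root_twoTorsionPolynomial_eq_three W hirr hβ
  have hodd3 : ¬ 2 ∣ Module.finrank ℚ ↥(IntermediateField.adjoin ℚ ({β} : Set (AlgebraicClosure ℚ))) := by rw [hfin3]; decide
  have hs2 := ncard_adjoin_le_two_of_not_onKilfordStratumAtTwo W ht hs hβ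
  have hram := totallyRamifiedFrom_zero_adjoin_of_isOrdinaryAt_two W hord ht hβ κP hκP
  refine ⟨fun m hm => ?_, ?_⟩
  · exact classNumberPExp_eq_of_le_of_layerTwo_unitCert κP hκP hodd3 hram hh hs2 𝔭₁ hN hunr h0 h1 h2c h3 hπ₁ hπ₁' hd hγ₀
      hA hB hC hD hm
  · exact classicalMuVanishes_two_of_layerTwo_unitCert κP hκP hodd3 hram hh hs2 𝔭₁ hN hunr h0 h1 h2c h3 hπ₁ hπ₁' hd hγ₀ hA hB hC hD

/-! ## §2 The door into `MC₂(W)` -/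

variable [W.IsGloballyMinimal]

/-- **THE LAYER-TWO UNIT DOOR INTO `MC₂(W)`.**  PRINT⁵ {Kato 17.4 (1)(2) at `2` (`h17`), Greenberg 4.1 (`hGr`), period unit (`hper`), modularity
(`hmod`), GZK (`hGZK`)} + MuIneqʳ (`hI`, the registered stub VERBATIM) + the cell hypotheses (good ordinary at `2`, no rational `2`-torsion abscissa,
`Δ_W < 0`, `r_an = 0`, analytic `μ₂ = 0` on the even branch, `BSD₂(W)`) + OFF the Kilford stratum + `β` a root of the `2`-division cubic + the displayed
data of `ℚ(β)` (`h(ℚ(β))` odd; `𝔭₁` of norm `2`, `2 ∉ 𝔭₁²`; `A, …, D', π₁, d, γ₀, …, γ₃ ∈ 𝓞 ℚ(β)` with the layer-two unit certificate) ⟹ `MC₂(W)`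
(att-p5 g24's cubic carrier road ∘ §1).  For the sub-cell `Δ_min ≡ 5 (mod 8)` with `σ₁(ε) ≡ ±1 (mod 16)` and `e₁ ≥ 2` this is the first door that can fire.
[cite: Fukuda1994, Thm. 1 (1), p. 264] [cite: Kato2004Asterisque, Thm. 17.4 (1)(2) (p. 273)] [cite: GreenbergLNM1716, Thm. 4.1 (p. 102) and Conj. 1.11 (p. 58)]
[cite: Iwasawa1973MuInvariants, Thm. 2 and Thm. 3] [cite: Omeara1963, §63B (63:10)] -/
theorem mazurMainConjecture_two_of_muIneqRel_of_layerTwoUnitCert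
    (h17 : ∀ [NeZero (W.conductorNorm ℤ)] (f : CuspForm (Gamma0 (W.conductorNorm ℤ)) 2),
      kato_divisibility_allPrimes W 2 (f := f))
    (hGr : Greenberg1999.thm41_charValue_rankZero_anyPrime)
    (hper : realPeriodRat_eq_unit_mul_plusPeriod_two) (hmod : nonempty_modularParametrizationData)
    (hGZK : rank_eq_analyticRank_of_analyticRank_le_one)
    (hI : ∀ (W : WeierstrassCurve ℚ) [W.IsElliptic] [W.IsGloballyMinimal], IsOrdinaryAt W 2 →
      (∀ x : ℚ, ¬ HasRationalTwoTorsionX W x) →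
      ∀ (κ : ZpExtension ℚ 2) (γ : Field.absoluteGaloisGroup ℚ), κ.IsCyclotomic →
      κ.IsTopGenerator γ → IsCyclotomicVariable 2 γ →
      ∀ ⦃N : ℕ⦄ [NeZero N] (f : CuspForm (Gamma0 N) 2), IsNewformOf W f →
      ∀ Gp : IwasawaAlgebra 2, iwasawaToPowerSeries 2 Gp = padicLFunction f (unitRoot W 2 : ℚ_[2]) →
      ∀ (D : W.SelmerDualData κ γ) (Yr : W.FineSelmerDualDataRelaxedInf κ γ),
        lengthAt (IwasawaAlgebra 2) D.X ⟨IwasawaAlgebra.augIdealP 2, IwasawaAlgebra.isPrime_augIdealP_holds 2⟩ ≤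
          lengthAt (IwasawaAlgebra 2) (IwasawaAlgebra 2 ⧸ Ideal.span {Gp})
              ⟨IwasawaAlgebra.augIdealP 2, IwasawaAlgebra.isPrime_augIdealP_holds 2⟩ +
            lengthAt (IwasawaAlgebra 2) Yr.X ⟨IwasawaAlgebra.augIdealP 2, IwasawaAlgebra.isPrime_augIdealP_holds 2⟩)
    (hord : IsOrdinaryAt W 2) (ht : ∀ x : ℚ, ¬ HasRationalTwoTorsionX W x) (hΔ : W.Δ < 0) (hr : W.analyticRank = 0)
    (hμan : ∀ ⦃N : ℕ⦄ [NeZero N] (f : CuspForm (Gamma0 N) 2), IsNewformOf W f →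
      ∀ G : IwasawaAlgebra 2, IsEvenBranchLiftAtTwo W f G → red G ≠ 0)
    (hbsd : BSDp W 2) (hs : ¬ OnKilfordStratumAtTwo W)
    {β : AlgebraicClosure ℚ} (hβ : aeval β W.twoTorsionPolynomial.toPoly = 0)
    (hh : haveI : FiniteDimensional ℚ ↥(IntermediateField.adjoin ℚ ({β} : Set (AlgebraicClosure ℚ))) :=
        IntermediateField.adjoin.finiteDimensional ((AlgebraicClosure.isAlgebraic ℚ).isAlgebraic β).isIntegral
      haveI : NumberField ↥(IntermediateField.adjoin ℚ ({β} : Set (AlgebraicClosure ℚ))) := NumberField.mk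
      ¬ 2 ∣ classNumber ↥(IntermediateField.adjoin ℚ ({β} : Set (AlgebraicClosure ℚ))))
    (𝔭₁ : Ideal (𝓞 ↥(IntermediateField.adjoin ℚ ({β} : Set (AlgebraicClosure ℚ)))))
    (hN : haveI : FiniteDimensional ℚ ↥(IntermediateField.adjoin ℚ ({β} : Set (AlgebraicClosure ℚ))) :=
        IntermediateField.adjoin.finiteDimensional ((AlgebraicClosure.isAlgebraic ℚ).isAlgebraic β).isIntegral
      haveI : NumberField ↥(IntermediateField.adjoin ℚ ({β} : Set (AlgebraicClosure ℚ))) := NumberField.mk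
      Ideal.absNorm 𝔭₁ = 2)
    (hunr : (2 : 𝓞 ↥(IntermediateField.adjoin ℚ ({β} : Set (AlgebraicClosure ℚ)))) ∉ 𝔭₁ ^ 2)
    {A B C D A' B' C' D' π₁ d γ₀ γ₁ γ₂ γ₃ : 𝓞 ↥(IntermediateField.adjoin ℚ ({β} : Set (AlgebraicClosure ℚ)))}
    (h0 : A * A' - 2 * (B * D' + C * C' + D * B') - 8 * (D * D') = 1)
    (h1 : A * B' + B * A' - 2 * (C * D' + D * C') = 0)
    (h2c : A * C' + B * B' + C * A' + 4 * (B * D' + C * C' + D * B') + 14 * (D * D') = 0)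
    (h3 : A * D' + B * C' + C * B' + D * A' + 4 * (C * D' + D * C') = 0)
    (hπ₁ : π₁ ∈ 𝔭₁) (hπ₁' : π₁ ∉ 𝔭₁ ^ 2) (hd : d ∉ 𝔭₁) (hγ₀ : γ₀ ∉ 𝔭₁)
    (hA : d * (A - 1) = π₁ ^ 2 * γ₀) (hB : d * B = π₁ ^ 2 * γ₁) (hC : d * C = π₁ ^ 2 * γ₂) (hD : d * D = π₁ ^ 2 * γ₃) :
    MazurMainConjecture W 2 :=
  mazurMainConjecture_two_of_muIneqRel_of_classicalMu_cubicField_of_Δ_neg W h17 hGr hper hmod hGZK hI hord ht hΔ hr hμan hbsd hβ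
    fun κP hκP => (classicalMuVanishes_adjoin_of_layerTwoUnitCert W hord ht hs hβ hh 𝔭₁ hN hunr h0 h1 h2c h3 hπ₁ hπ₁' hd hγ₀ hA hB hC
      hD κP hκP).2.1

/-! ## §3 The principal form `𝔭₁ = (π₁)` (class number one seeds): every side condition as an identity in `𝓞 ℚ(β)` -/

/-- `π ∉ (π)²` for a non-zero non-unit `π` of a domain. [folklore] -/
private theorem not_mem_span_singleton_sq {R : Type*} [CommRing R] [IsDomain R] {π : R} (hπ0 : π ≠ 0) (hπu : ¬ IsUnit π) :
    π ∉ Ideal.span {π} ^ 2 := by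
  rw [Ideal.span_singleton_pow, Ideal.mem_span_singleton]
  rintro ⟨x, hx⟩
  apply hπu
  have h1 : π * (1 - π * x) = 0 := by linear_combination hx
  rcases mul_eq_zero.mp h1 with h | h
  · exact absurd h hπ0
  · exact IsUnit.of_mul_eq_one x (by linear_combination -h)

/-- `x ≡ 1 (mod I)` (witnessed: `x − 1 = π y`, `π ∈ I`) and `I ≠ ⊤` give `x ∉ I`. [folklore] -/
private theorem not_mem_of_sub_one_eq {R : Type*} [CommRing R] {I : Ideal R} (hI : I ≠ ⊤) {x y π : R} (hπ : π ∈ I)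
    (h : x - 1 = π * y) : x ∉ I := fun hx => hI (I.eq_top_of_isUnit_mem (x := 1)
  (by have : x - π * y ∈ I := I.sub_mem hx (I.mul_mem_right _ hπ); rwa [show x - π * y = 1 by linear_combination h] at this) isUnit_one)

/-- **THE LAYER-TWO UNIT DOOR INTO `MC₂(W)`, PRINCIPAL FORM** (`h(ℚ(β)) = 1` seeds, `𝔭₁ = (π₁)`): the side conditions of
`mazurMainConjecture_two_of_muIneqRel_of_layerTwoUnitCert` become identities in `𝓞 ℚ(β)` — displayed: `h(ℚ(β))` odd, `N((π₁)) = 2`, `2 ∉ (π₁)²`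
(e.g. from `2 ∤ d_{ℚ(β)}`, Literature `two_not_mem_sq_of_not_dvd_discr`), and `A, …, D', d, γ₀, …, γ₃, y_d, y_γ ∈ 𝓞 ℚ(β)` with the four unit identities,
`d − 1 = π₁ y_d`, `γ₀ − 1 = π₁ y_γ`, `d(A − 1) = π₁²γ₀`, `dB = π₁²γ₁`, `dC = π₁²γ₂`, `dD = π₁²γ₃` (`π₁ ∉ (π₁)²` is automatic, `d, γ₀ ∉ (π₁)` from the
two congruences).  With PRINT⁵ + MuIneqʳ + the cell hypotheses (`Δ_W < 0`) + OFF the stratum ⟹ `MC₂(W)`. [cite: Fukuda1994, Thm. 1 (1), p. 264]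
[cite: Kato2004Asterisque, Thm. 17.4 (1)(2) (p. 273)] [cite: GreenbergLNM1716, Thm. 4.1 (p. 102) and Conj. 1.11 (p. 58)] [cite: Omeara1963, §63B (63:10)] -/
theorem mazurMainConjecture_two_of_muIneqRel_of_layerTwoUnitCert_principal
    (h17 : ∀ [NeZero (W.conductorNorm ℤ)] (f : CuspForm (Gamma0 (W.conductorNorm ℤ)) 2),
      kato_divisibility_allPrimes W 2 (f := f))
    (hGr : Greenberg1999.thm41_charValue_rankZero_anyPrime)
    (hper : realPeriodRat_eq_unit_mul_plusPeriod_two) (hmod : nonempty_modularParametrizationData)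
    (hGZK : rank_eq_analyticRank_of_analyticRank_le_one)
    (hI : ∀ (W : WeierstrassCurve ℚ) [W.IsElliptic] [W.IsGloballyMinimal], IsOrdinaryAt W 2 →
      (∀ x : ℚ, ¬ HasRationalTwoTorsionX W x) →
      ∀ (κ : ZpExtension ℚ 2) (γ : Field.absoluteGaloisGroup ℚ), κ.IsCyclotomic →
      κ.IsTopGenerator γ → IsCyclotomicVariable 2 γ →
      ∀ ⦃N : ℕ⦄ [NeZero N] (f : CuspForm (Gamma0 N) 2), IsNewformOf W f →
      ∀ Gp : IwasawaAlgebra 2, iwasawaToPowerSeries 2 Gp = padicLFunction f (unitRoot W 2 : ℚ_[2]) →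
      ∀ (D : W.SelmerDualData κ γ) (Yr : W.FineSelmerDualDataRelaxedInf κ γ),
        lengthAt (IwasawaAlgebra 2) D.X ⟨IwasawaAlgebra.augIdealP 2, IwasawaAlgebra.isPrime_augIdealP_holds 2⟩ ≤
          lengthAt (IwasawaAlgebra 2) (IwasawaAlgebra 2 ⧸ Ideal.span {Gp})
              ⟨IwasawaAlgebra.augIdealP 2, IwasawaAlgebra.isPrime_augIdealP_holds 2⟩ +
            lengthAt (IwasawaAlgebra 2) Yr.X ⟨IwasawaAlgebra.augIdealP 2, IwasawaAlgebra.isPrime_augIdealP_holds 2⟩)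
    (hord : IsOrdinaryAt W 2) (ht : ∀ x : ℚ, ¬ HasRationalTwoTorsionX W x) (hΔ : W.Δ < 0) (hr : W.analyticRank = 0)
    (hμan : ∀ ⦃N : ℕ⦄ [NeZero N] (f : CuspForm (Gamma0 N) 2), IsNewformOf W f →
      ∀ G : IwasawaAlgebra 2, IsEvenBranchLiftAtTwo W f G → red G ≠ 0)
    (hbsd : BSDp W 2) (hs : ¬ OnKilfordStratumAtTwo W)
    {β : AlgebraicClosure ℚ} (hβ : aeval β W.twoTorsionPolynomial.toPoly = 0)
    (hh : haveI : FiniteDimensional ℚ ↥(IntermediateField.adjoin ℚ ({β} : Set (AlgebraicClosure ℚ))) :=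
        IntermediateField.adjoin.finiteDimensional ((AlgebraicClosure.isAlgebraic ℚ).isAlgebraic β).isIntegral
      haveI : NumberField ↥(IntermediateField.adjoin ℚ ({β} : Set (AlgebraicClosure ℚ))) := NumberField.mk
      ¬ 2 ∣ classNumber ↥(IntermediateField.adjoin ℚ ({β} : Set (AlgebraicClosure ℚ))))
    {π₁ A B C D A' B' C' D' d γ₀ γ₁ γ₂ γ₃ yd yγ : 𝓞 ↥(IntermediateField.adjoin ℚ ({β} : Set (AlgebraicClosure ℚ)))}
    (hN : haveI : FiniteDimensional ℚ ↥(IntermediateField.adjoin ℚ ({β} : Set (AlgebraicClosure ℚ))) :=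
        IntermediateField.adjoin.finiteDimensional ((AlgebraicClosure.isAlgebraic ℚ).isAlgebraic β).isIntegral
      haveI : NumberField ↥(IntermediateField.adjoin ℚ ({β} : Set (AlgebraicClosure ℚ))) := NumberField.mk
      Ideal.absNorm (Ideal.span {π₁}) = 2)
    (hunr : (2 : 𝓞 ↥(IntermediateField.adjoin ℚ ({β} : Set (AlgebraicClosure ℚ)))) ∉ Ideal.span {π₁} ^ 2)
    (h0 : A * A' - 2 * (B * D' + C * C' + D * B') - 8 * (D * D') = 1)
    (h1 : A * B' + B * A' - 2 * (C * D' + D * C') = 0)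
    (h2c : A * C' + B * B' + C * A' + 4 * (B * D' + C * C' + D * B') + 14 * (D * D') = 0)
    (h3 : A * D' + B * C' + C * B' + D * A' + 4 * (C * D' + D * C') = 0)
    (hd : d - 1 = π₁ * yd) (hγ₀ : γ₀ - 1 = π₁ * yγ)
    (hA : d * (A - 1) = π₁ ^ 2 * γ₀) (hB : d * B = π₁ ^ 2 * γ₁) (hC : d * C = π₁ ^ 2 * γ₂) (hD : d * D = π₁ ^ 2 * γ₃) :
    MazurMainConjecture W 2 := by
  have hβint : IsIntegral ℚ β := ((AlgebraicClosure.isAlgebraic ℚ).isAlgebraic β).isIntegral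
  haveI : FiniteDimensional ℚ ↥(IntermediateField.adjoin ℚ ({β} : Set (AlgebraicClosure ℚ))) :=
    IntermediateField.adjoin.finiteDimensional hβint
  haveI : NumberField ↥(IntermediateField.adjoin ℚ ({β} : Set (AlgebraicClosure ℚ))) := NumberField.mk
  have htop : Ideal.span {π₁} ≠ (⊤ : Ideal (𝓞 ↥(IntermediateField.adjoin ℚ ({β} : Set (AlgebraicClosure ℚ))))) := fun h => by
    rw [h, Ideal.absNorm_top] at hN; exact absurd hN (by norm_num)
  have hπu : ¬ IsUnit π₁ := fun h => htop (Ideal.span_singleton_eq_top.mpr h)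
  have hπ0 : π₁ ≠ 0 := fun h => by
    rw [h, Ideal.span_singleton_zero] at hN
    change Ideal.absNorm (⊥ : Ideal _) = 2 at hN
    rw [Ideal.absNorm_bot] at hN; exact absurd hN (by norm_num)
  exact mazurMainConjecture_two_of_muIneqRel_of_layerTwoUnitCert W h17 hGr hper hmod hGZK hI hord ht hΔ hr hμan hbsd hs hβ hh
    (Ideal.span {π₁}) hN hunr h0 h1 h2c h3 (Ideal.mem_span_singleton_self π₁) (not_mem_span_singleton_sq hπ0 hπu)
    (not_mem_of_sub_one_eq htop (Ideal.mem_span_singleton_self π₁) hd)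
    (not_mem_of_sub_one_eq htop (Ideal.mem_span_singleton_self π₁) hγ₀) hA hB hC hD

end Summit.BirchSwinnertonDyer.BirchSwinnertonDyer.Theorems.AlignedTransportAtTwoCubicLayerTwoUnitDoor

end
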